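import Summits.QuantumFields.BalabanUV.T4Continuum.Support.GaugeTermDecomposition

/-!
# T⁴ programme, spine node NE2 (U1a) — THE GAUGE-TERM SANDWICH, ONE-LEVEL (H-bd) BOUND (tier B, row B4.a of
# `t4/SKELETON-NE2-P1.md`, companion of `Support/GaugeTermDecomposition`)

NE2 formalisation swarm `t4-ne2-formalise-*`, seat LEAF 10 (unit `b2b-balaban-t4-ne2-formalise-leaf-10`).  File 1 typed the covariant
gradient on colour 0-forms `D_R`, its defect `E = D_R − ∂ ⊗ 1`, the sandwich `D_R·X·D_Rᴴ` (the shape of `DRD*` in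
[Balaban1985BackgroundPropagators] (3.26) p.395 / `∂P∂*` in [Balaban1984PropagatorsI] (1.69) p.29, with the 0-form operator `X` as
DATA), the exact four-term decomposition `D_R X D_Rᴴ − D_1 X₀ D_1ᴴ = G(X − X₀)Gᴴ + E X Gᴴ + G X Eᴴ + E X Eᴴ` (`G = ∂ ⊗ 1`) and the
generic bound `‖G·X·B‖ ≤ d(ξb₁ + ρb₀)` under gradient-commutator data `GradComm X ξ ρ`.  Here, at one level `η = 1/n`:

 * §1 the (1.89) inputs in the shapes the decomposition needs: `∇_μᴴ = −S_μᴴ∇_μ`; **`‖∂ᴴ𝒢‖ ≤ d·Cst`** (tree `‖𝒢∇_μ‖ ≤ Cst`,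
   `𝒢ᴴ = 𝒢`); **`‖∂_λ·∂ᴴ·𝒢‖ ≤ d·Cst`** — TWO differences on one side of `𝒢`, from the tree's fifth bound
   `B5Prop11Plancherel.opNorm_fdiff_fdiff_calG_le`; **`‖(∂_λ ⊗ 1)·Eᴴ·(𝒢 ⊗ 1)‖ ≤ d(α + β)Cst`** from the size `α` and the Lipschitz
   constant `β` (per lattice step, lattice units) of the connection `w = n(R − 1)`, by the colour Leibniz rule;
 * §2 **`opNorm_sandDiff_mul_calG_le`** (H-bd, right):
   `‖(D_R X D_Rᴴ − D_1 X₀ D_1ᴴ)·(𝒢 ⊗ 1)‖ ≤ κ_sand := d²·Cst·[(ξ₀ + ρ₀) + αξ + (ξ(α + β) + ρα) + α²ξ]`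
   for `GradComm X ξ ρ`, `GradComm (X − X₀) ξ₀ ρ₀`; **`opNorm_calG_mul_sandDiff_le`** (H-bd, left) under the data of the adjoints
   `Xᴴ`, `(X − X₀)ᴴ` (the same for Hermitian `X`, `X₀`), by `𝒢ᴴ = 𝒢` and `(D X Dᴴ)ᴴ = D Xᴴ Dᴴ`.
 At `t = 1` the law needs `κ_sand < 1`, i.e. SMALL `ξ₀, ρ₀` (the gauge projection moves little, and smoothly, with the background)
 and small `α, β` (small field) — displayed, not assumed abstractly.  (H-cons) and the tower packaging are row B4.b.
 * §3 the projection FACTORISED through inner data, as row B4.b reads it (journal l.5510): `scalOp = D_RᴴD_R + a′Q′ᴴQ′` ((3.24) shape,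
   Hermitian), `Zop = Q′G′D_Rᴴ`, `Nop = (Q′G′²Q′ᴴ)⁻¹`, `projP = G′Q′ᴴ·Nop·Q′G′` ((3.25) shape; Hermitian, idempotent when the middle
   matrix is invertible), the EXACT identity **`sand_projP_eq`** `D_R·P·D_Rᴴ = Zᴴ·N·Z` and the three-term split **`sand_projP_sub`** of
   `D_R P_U D_Rᴴ − D_1 P_1 D_1ᴴ` into bounded factors — the commutator-free route to (H-bd) for THIS middle operator.

HONEST FRAMING (T4-DAG p. 1).  [folklore] operator-norm bookkeeping, OURS; the only printed input is (1.89) through the tree's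
kernel theorems; `X`, `X₀`, `R` are DATA — whether Bałaban's `R(U_k)` of (3.25) p.394 satisfies `GradComm` with small `ξ₀, ρ₀`
against `R(1)` is NOT claimed (per trigger c4 a failure there is a LOCATED NON-APPLICABILITY of row B4, to be declared, not
hidden); finite torus, linear layer, operator norm; NOT [B9] (3.23)–(3.26) as printed; NE2 NOT proved; NOT infinite volume / mass
gap / Clay / summit progress; spine 0/9 unchanged.  HONEST DEPENDENCY: continuum YM on T⁴ ⇐ BetaPertH ∧ nine spine estimates (0/9
proved); BetaPertH ⇐ (D1) ∧ (D4) ∧ CAP+tail; G-an2-4 gates asym, D1 and NE2/3/4.  ABSOLUTE RULE kept; no `sorry`.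
-/

noncomputable section

open scoped BigOperators ComplexConjugate Matrix Matrix.Norms.L2Operator Kronecker

namespace Summit.QuantumFields.BalabanUV.T4Continuum.GaugeTermSandwichBound

open Literature.MathematicalPhysics.QuantumFieldTheory.Balaban1983to89.B5Prop11Plancherel
open Literature.MathematicalPhysics.QuantumFieldTheory.Balaban1983to89.B5Action121 (shiftS sdiff GradOp)
open Summit.QuantumFields.BalabanUV.T4Continuum
open Summit.QuantumFields.BalabanUV.T4Continuum.BlockPairingGeometry (tau opNorm_shiftM_le fdiff_eq_neg_conjTranspose_mul)
open Summit.QuantumFields.BalabanUV.T4Continuum.BlockPairingFaces (opNorm_calG_mul_fdiff_le)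
open Summit.QuantumFields.BalabanUV.T4Continuum.KroneckerLift
open Summit.QuantumFields.BalabanUV.T4Continuum.BlockMultiplication
open Summit.QuantumFields.BalabanUV.T4Continuum.KroneckerUnits
open Summit.QuantumFields.BalabanUV.T4Continuum.GaugeTermDecomposition

variable {d : ℕ}

/-! ## §1 The (1.89) inputs in sandwich form -/

section Level

variable (n : ℕ) [NeZero n] (hn : 1 ≤ n) (M : Fin d → ℕ) [hM : ∀ μ, NeZero (M μ)] (a : ℝ) (ha : 0 < a)
  {o : Type*} [Fintype o] [DecidableEq o]

omit [NeZero n] in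
/-- `∇_μᴴ = −S_μᴴ∇_μ` for the real lattice factor `n`. [folklore] -/
theorem fdiffH_eq [NeZero n] (μ : Fin d) :
    (fdiff (fine n M) ((n : ℕ) : ℂ) μ)ᴴ = -((shiftM (fine n M) μ)ᴴ * fdiff (fine n M) ((n : ℕ) : ℂ) μ) := by
  have e : ((n : ℕ) : ℂ) = ((n : ℝ) : ℂ) := by push_cast; rfl
  have h1 := congrArg Matrix.conjTranspose (fdiff_eq_neg_conjTranspose_mul (fine n M) (n : ℝ) μ)
  rw [Matrix.conjTranspose_neg, Matrix.conjTranspose_mul, Matrix.conjTranspose_conjTranspose] at h1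
  rw [e]; exact h1

/-- (1.89) in gradient form: **`‖∂ᴴ𝒢‖ ≤ d·Cst`** (from the tree's `‖𝒢∇_μ‖ ≤ Cst` and `𝒢ᴴ = 𝒢`). [cite: Balaban1984PropagatorsI,
Prop. 1.1 (1.89) p.33] [folklore] -/
theorem opNorm_gradH_mul_calG_le : ‖(GradOp (fine n M) ((n : ℕ) : ℂ))ᴴ * calG n hn M a ha‖ ≤ d * Cst d a := by
  rw [GradOp_eq_sum_fdiff, Matrix.conjTranspose_sum, Matrix.sum_mul]
  refine (norm_sum_le _ _).trans ?_
  have hterm : ∀ μ ∈ Finset.univ, ‖(fdiff (fine n M) ((n : ℕ) : ℂ) μ * injM (fine n M) μ)ᴴ * calG n hn M a ha‖ ≤ Cst d a := by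
    intro μ _
    rw [Matrix.conjTranspose_mul, Matrix.mul_assoc]
    have h1 : ‖(fdiff (fine n M) ((n : ℕ) : ℂ) μ)ᴴ * calG n hn M a ha‖ ≤ Cst d a := by
      have e : (fdiff (fine n M) ((n : ℕ) : ℂ) μ)ᴴ * calG n hn M a ha = (calG n hn M a ha * fdiff (fine n M) ((n : ℕ) : ℂ) μ)ᴴ := by
        rw [Matrix.conjTranspose_mul, (calG_isHermitian n hn M a ha).eq]
      rw [e, Matrix.l2_opNorm_conjTranspose]; exact opNorm_calG_mul_fdiff_le n M a ha hn μ
    calc _ ≤ ‖(injM (fine n M) μ)ᴴ‖ * ‖(fdiff (fine n M) ((n : ℕ) : ℂ) μ)ᴴ * calG n hn M a ha‖ := Matrix.l2_opNorm_mul _ _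
      _ ≤ 1 * Cst d a := mul_le_mul (opNorm_injM_conjTranspose_le _ μ) h1 (norm_nonneg _) zero_le_one
      _ = Cst d a := one_mul _
  refine (Finset.sum_le_sum hterm).trans (le_of_eq ?_)
  rw [Finset.sum_const, Finset.card_univ, Fintype.card_fin, nsmul_eq_mul]

/-- (1.89) with TWO differences on one side: **`‖∂_λ·∂ᴴ·𝒢‖ ≤ d·Cst`** (`∂_λ injM_μᴴ∇_μᴴ𝒢 = −injM_μᴴS_μᴴ·∇_λ∇_μ𝒢` and the tree's
fifth bound `‖∇_λ∇_μ𝒢‖ ≤ Cst`). [cite: Balaban1984PropagatorsI, Prop. 1.1 (1.89) p.33] [folklore] -/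
theorem opNorm_sdiff_gradH_mul_calG_le (lam : Fin d) :
    ‖sdiff (fine n M) ((n : ℕ) : ℂ) lam * (GradOp (fine n M) ((n : ℕ) : ℂ))ᴴ * calG n hn M a ha‖ ≤ d * Cst d a := by
  rw [GradOp_eq_sum_fdiff, Matrix.conjTranspose_sum, Matrix.mul_sum, Matrix.sum_mul]
  refine (norm_sum_le _ _).trans ?_
  have hterm : ∀ μ ∈ Finset.univ,
      ‖sdiff (fine n M) ((n : ℕ) : ℂ) lam * (fdiff (fine n M) ((n : ℕ) : ℂ) μ * injM (fine n M) μ)ᴴ * calG n hn M a ha‖ ≤ Cst d a := by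
    intro μ _
    have e : sdiff (fine n M) ((n : ℕ) : ℂ) lam * (fdiff (fine n M) ((n : ℕ) : ℂ) μ * injM (fine n M) μ)ᴴ * calG n hn M a ha
        = -((injM (fine n M) μ)ᴴ * (shiftM (fine n M) μ)ᴴ
            * (fdiff (fine n M) ((n : ℕ) : ℂ) lam * fdiff (fine n M) ((n : ℕ) : ℂ) μ * calG n hn M a ha)) := by
      rw [Matrix.conjTranspose_mul, fdiffH_eq n M μ, ← Matrix.mul_assoc (sdiff (fine n M) ((n : ℕ) : ℂ) lam),
        ← injMH_mul_fdiff, Matrix.mul_neg, Matrix.neg_mul, Matrix.mul_assoc ((injM (fine n M) μ)ᴴ) (fdiff (fine n M) ((n : ℕ) : ℂ) lam),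
        ← Matrix.mul_assoc (fdiff (fine n M) ((n : ℕ) : ℂ) lam), fdiff_mul_conjTranspose_shiftM]
      simp only [Matrix.mul_assoc]
    rw [e, norm_neg]
    have hS : ‖(injM (fine n M) μ)ᴴ * (shiftM (fine n M) μ)ᴴ‖ ≤ 1 :=
      (Matrix.l2_opNorm_mul _ _).trans ((mul_le_mul (opNorm_injM_conjTranspose_le _ μ)
        (by rw [Matrix.l2_opNorm_conjTranspose]; exact opNorm_shiftM_le _ μ) (norm_nonneg _) zero_le_one).trans (le_of_eq (one_mul 1)))
    calc _ ≤ ‖(injM (fine n M) μ)ᴴ * (shiftM (fine n M) μ)ᴴ‖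
              * ‖fdiff (fine n M) ((n : ℕ) : ℂ) lam * fdiff (fine n M) ((n : ℕ) : ℂ) μ * calG n hn M a ha‖ := Matrix.l2_opNorm_mul _ _
      _ ≤ 1 * Cst d a := mul_le_mul hS (opNorm_fdiff_fdiff_calG_le n hn M a ha lam μ) (norm_nonneg _) zero_le_one
      _ = Cst d a := one_mul _
  refine (Finset.sum_le_sum hterm).trans (le_of_eq ?_)
  rw [Finset.sum_const, Finset.card_univ, Fintype.card_fin, nsmul_eq_mul]

/-- **the defect's adjoint under one difference**: `‖(∂_λ ⊗ 1)·Eᴴ·(𝒢 ⊗ 1)‖ ≤ d(α + β)Cst` from the size `α` and the LIPSCHITZ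
bound `‖w_μ(x + e_λ) − w_μ(x)‖ ≤ β/n` of the connection, the colour Leibniz rule and (1.89) `‖∇_λ𝒢‖ ≤ Cst`.
[cite: Balaban1984PropagatorsI, Prop. 1.1 (1.89) p.33, (1.31) p.23] [folklore] -/
theorem opNorm_sdiff_defectH_mul_calG_le {R : Fin d → (Tor (fine n M) → Matrix o o ℂ)} {α β : ℝ} (hα : 0 ≤ α) (hβ : 0 ≤ β)
    (hR : ∀ μ i, ‖connL (fine n M) ((n : ℕ) : ℂ) R μ i‖ ≤ α)
    (hLip : ∀ μ lam i, ‖connL (fine n M) ((n : ℕ) : ℂ) R μ (tau (fine n M) lam i) - connL (fine n M) ((n : ℕ) : ℂ) R μ i‖ ≤ β / n)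
    (lam : Fin d) :
    ‖sdiff (fine n M) ((n : ℕ) : ℂ) lam ⊗ₖ (1 : Matrix o o ℂ) * (defect (fine n M) ((n : ℕ) : ℂ) R)ᴴ
        * (calG n hn M a ha ⊗ₖ (1 : Matrix o o ℂ))‖ ≤ d * (α + β) * Cst d a := by
  have hnpos : (0 : ℝ) < n := by exact_mod_cast hn
  have hC := Cst_nonneg d a
  set c : ℂ := ((n : ℕ) : ℂ) with hc
  set G := calG n hn M a ha ⊗ₖ (1 : Matrix o o ℂ) with hG
  rw [defect, Matrix.conjTranspose_sum, Matrix.mul_sum, Matrix.sum_mul]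
  refine (norm_sum_le _ _).trans ?_
  have hterm : ∀ μ ∈ Finset.univ, ‖sdiff (fine n M) c lam ⊗ₖ (1 : Matrix o o ℂ)
      * (siteMul (connL (fine n M) c R μ) * shiftM (fine n M) μ ⊗ₖ (1 : Matrix o o ℂ) * injM (fine n M) μ ⊗ₖ (1 : Matrix o o ℂ))ᴴ * G‖
      ≤ (α + β) * Cst d a := by
    intro μ _
    set w : Tor (fine n M) × Fin d → Matrix o o ℂ := fun i => (connL (fine n M) c R μ i)ᴴ with hw
    -- move the difference to the propagator
    have e : sdiff (fine n M) c lam ⊗ₖ (1 : Matrix o o ℂ)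
        * (siteMul (connL (fine n M) c R μ) * shiftM (fine n M) μ ⊗ₖ (1 : Matrix o o ℂ) * injM (fine n M) μ ⊗ₖ (1 : Matrix o o ℂ))ᴴ * G
        = (injM (fine n M) μ)ᴴ ⊗ₖ (1 : Matrix o o ℂ) * ((shiftM (fine n M) μ)ᴴ ⊗ₖ (1 : Matrix o o ℂ))
          * (siteMul (w ∘ tau (fine n M) lam) * (fdiff (fine n M) c lam ⊗ₖ (1 : Matrix o o ℂ) * G)
            + c • (siteMul (w ∘ tau (fine n M) lam) - siteMul w) * G) := by
      have h1 : sdiff (fine n M) c lam ⊗ₖ (1 : Matrix o o ℂ) * (injM (fine n M) μ)ᴴ ⊗ₖ (1 : Matrix o o ℂ)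
          = (injM (fine n M) μ)ᴴ ⊗ₖ (1 : Matrix o o ℂ) * fdiff (fine n M) c lam ⊗ₖ (1 : Matrix o o ℂ) := by
        rw [← kron_mul, ← injMH_mul_fdiff, kron_mul]
      have h2 : fdiff (fine n M) c lam ⊗ₖ (1 : Matrix o o ℂ) * (shiftM (fine n M) μ)ᴴ ⊗ₖ (1 : Matrix o o ℂ)
          = (shiftM (fine n M) μ)ᴴ ⊗ₖ (1 : Matrix o o ℂ) * fdiff (fine n M) c lam ⊗ₖ (1 : Matrix o o ℂ) := by
        rw [← kron_mul, fdiff_mul_conjTranspose_shiftM, kron_mul]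
      have h3 := kronFdiff_mul_siteMul (fine n M) c lam w (o := o)
      rw [Matrix.conjTranspose_mul, Matrix.conjTranspose_mul, siteMul_conjTranspose, ← hw, kron_conjTranspose, kron_conjTranspose]
      calc sdiff (fine n M) c lam ⊗ₖ (1 : Matrix o o ℂ) * ((injM (fine n M) μ)ᴴ ⊗ₖ (1 : Matrix o o ℂ)
              * ((shiftM (fine n M) μ)ᴴ ⊗ₖ (1 : Matrix o o ℂ) * siteMul w)) * G
          = (sdiff (fine n M) c lam ⊗ₖ (1 : Matrix o o ℂ) * (injM (fine n M) μ)ᴴ ⊗ₖ (1 : Matrix o o ℂ))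
              * (shiftM (fine n M) μ)ᴴ ⊗ₖ (1 : Matrix o o ℂ) * siteMul w * G := by simp only [Matrix.mul_assoc]
        _ = (injM (fine n M) μ)ᴴ ⊗ₖ (1 : Matrix o o ℂ) * (fdiff (fine n M) c lam ⊗ₖ (1 : Matrix o o ℂ)
              * (shiftM (fine n M) μ)ᴴ ⊗ₖ (1 : Matrix o o ℂ)) * siteMul w * G := by rw [h1]; simp only [Matrix.mul_assoc]
        _ = (injM (fine n M) μ)ᴴ ⊗ₖ (1 : Matrix o o ℂ) * (shiftM (fine n M) μ)ᴴ ⊗ₖ (1 : Matrix o o ℂ)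
              * (fdiff (fine n M) c lam ⊗ₖ (1 : Matrix o o ℂ) * siteMul w) * G := by rw [h2]; simp only [Matrix.mul_assoc]
        _ = _ := by rw [h3, Matrix.mul_assoc _ (_ + _) G, Matrix.add_mul, Matrix.mul_assoc (siteMul (w ∘ tau (fine n M) lam))]
    rw [e]
    have h1 : ‖(injM (fine n M) μ)ᴴ ⊗ₖ (1 : Matrix o o ℂ) * ((shiftM (fine n M) μ)ᴴ ⊗ₖ (1 : Matrix o o ℂ))‖ ≤ 1 :=
      (Matrix.l2_opNorm_mul _ _).trans ((mul_le_mul (opNorm_kron_le_of_le o (opNorm_injM_conjTranspose_le _ μ))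
        (opNorm_kron_le_of_le o (by rw [Matrix.l2_opNorm_conjTranspose]; exact opNorm_shiftM_le _ μ)) (norm_nonneg _) zero_le_one).trans
        (le_of_eq (one_mul 1)))
    have hwt : ∀ i, ‖(w ∘ tau (fine n M) lam) i‖ ≤ α := fun i => by
      simp only [Function.comp_apply, hw, Matrix.l2_opNorm_conjTranspose]; exact hR μ _
    have hp1 : ‖siteMul (w ∘ tau (fine n M) lam) * (fdiff (fine n M) c lam ⊗ₖ (1 : Matrix o o ℂ) * G)‖ ≤ α * Cst d a := by
      refine (Matrix.l2_opNorm_mul _ _).trans (mul_le_mul (opNorm_siteMul_le _ hα hwt) ?_ (norm_nonneg _) hα)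
      rw [hG, ← kron_mul]; exact opNorm_kron_le_of_le o (opNorm_fdiff_calG_le n hn M a ha lam)
    have hdiff : ‖siteMul (w ∘ tau (fine n M) lam) - siteMul w‖ ≤ β / n := by
      rw [← siteMul_sub]
      refine opNorm_siteMul_le _ (by positivity) fun i => ?_
      simp only [Function.comp_apply, hw, ← Matrix.conjTranspose_sub, Matrix.l2_opNorm_conjTranspose]
      exact hLip μ lam i
    have hp2 : ‖c • (siteMul (w ∘ tau (fine n M) lam) - siteMul w) * G‖ ≤ β * Cst d a := by
      rw [Matrix.smul_mul, norm_smul, hc, Complex.norm_natCast]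
      calc (n : ℝ) * ‖(siteMul (w ∘ tau (fine n M) lam) - siteMul w) * G‖ ≤ n * (β / n * Cst d a) :=
            mul_le_mul_of_nonneg_left ((Matrix.l2_opNorm_mul _ _).trans (mul_le_mul hdiff
              (by rw [hG]; exact opNorm_kron_le_of_le o (opNorm_calG_le n hn M a ha)) (norm_nonneg _) (by positivity))) hnpos.le
        _ = β * Cst d a := by field_simp
    calc _ ≤ ‖(injM (fine n M) μ)ᴴ ⊗ₖ (1 : Matrix o o ℂ) * ((shiftM (fine n M) μ)ᴴ ⊗ₖ (1 : Matrix o o ℂ))‖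
            * ‖siteMul (w ∘ tau (fine n M) lam) * (fdiff (fine n M) c lam ⊗ₖ (1 : Matrix o o ℂ) * G)
                + c • (siteMul (w ∘ tau (fine n M) lam) - siteMul w) * G‖ := Matrix.l2_opNorm_mul _ _
      _ ≤ 1 * (α * Cst d a + β * Cst d a) := mul_le_mul h1 ((norm_add_le _ _).trans (add_le_add hp1 hp2)) (norm_nonneg _) zero_le_one
      _ = (α + β) * Cst d a := by ring
  refine (Finset.sum_le_sum hterm).trans (le_of_eq ?_)
  rw [Finset.sum_const, Finset.card_univ, Fintype.card_fin, nsmul_eq_mul, mul_assoc]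

/-! ## §2 The (H-bd) bound for the gauge-term sandwich -/

/-- the Neumann constant of the gauge-term sandwich:
`κ_sand = d²·Cst·[(ξ₀ + ρ₀) + αξ + (ξ(α + β) + ρα) + α²ξ]`. [folklore] -/
def kappaSand (d : ℕ) (a α β ξ ρ ξ₀ ρ₀ : ℝ) : ℝ :=
  (d : ℝ) ^ 2 * Cst d a * (ξ₀ + ρ₀ + α * ξ + (ξ * (α + β) + ρ * α) + α * ξ * α)

/-- **(H-bd) FOR THE GAUGE-TERM SANDWICH, RIGHT**: for transporters with connection of size `α` and Lipschitz constant `β` (per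
lattice step, in lattice units), a middle operator with `GradComm X ξ ρ` and a difference with `GradComm (X − X₀) ξ₀ ρ₀`,
`‖(D_R X D_Rᴴ − D_1 X₀ D_1ᴴ)·(𝒢 ⊗ 1)‖ ≤ κ_sand` — term by term from the four-term decomposition: the new sandwich term costs
`d²Cst(ξ₀ + ρ₀)` (two differences on 𝒢 plus one commutator), the first-order terms `d²Cst·αξ` and `d²Cst(ξ(α + β) + ρα)`, the
zeroth-order term `d²Cst·α²ξ`. [cite: Balaban1984PropagatorsI, Prop. 1.1 (1.89) p.33] [folklore] -/
theorem opNorm_sandDiff_mul_calG_le {R : Fin d → (Tor (fine n M) → Matrix o o ℂ)} {X X₀ : Matrix (Tor (fine n M) × o) (Tor (fine n M) × o) ℂ}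
    {α β ξ ρ ξ₀ ρ₀ : ℝ} (hα : 0 ≤ α) (hβ : 0 ≤ β) (hR : ∀ μ i, ‖connL (fine n M) ((n : ℕ) : ℂ) R μ i‖ ≤ α)
    (hLip : ∀ μ lam i, ‖connL (fine n M) ((n : ℕ) : ℂ) R μ (tau (fine n M) lam i) - connL (fine n M) ((n : ℕ) : ℂ) R μ i‖ ≤ β / n)
    (hX : GradComm (fine n M) ((n : ℕ) : ℂ) X ξ ρ) (hY : GradComm (fine n M) ((n : ℕ) : ℂ) (X - X₀) ξ₀ ρ₀) :
    ‖(sand (fine n M) ((n : ℕ) : ℂ) R X - sand (fine n M) ((n : ℕ) : ℂ) (fun _ _ => 1) X₀) * (calG n hn M a ha ⊗ₖ (1 : Matrix o o ℂ))‖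
      ≤ kappaSand d a α β ξ ρ ξ₀ ρ₀ := by
  have hC := Cst_nonneg d a
  have hξ := hX.nonneg.1
  rw [sand_sub_sand]
  set G := GradOp (fine n M) ((n : ℕ) : ℂ) ⊗ₖ (1 : Matrix o o ℂ) with hG
  set E := defect (fine n M) ((n : ℕ) : ℂ) R with hE
  set 𝒢 := calG n hn M a ha ⊗ₖ (1 : Matrix o o ℂ) with h𝒢
  -- the right factors
  have hB0 : ‖Gᴴ * 𝒢‖ ≤ d * Cst d a := by
    rw [hG, h𝒢, kron_conjTranspose, ← kron_mul]; exact opNorm_kron_le_of_le o (opNorm_gradH_mul_calG_le n hn M a ha)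
  have hB1 : ∀ lam, ‖sdiff (fine n M) ((n : ℕ) : ℂ) lam ⊗ₖ (1 : Matrix o o ℂ) * (Gᴴ * 𝒢)‖ ≤ d * Cst d a := fun lam => by
    rw [hG, h𝒢, kron_conjTranspose, ← kron_mul, ← kron_mul, ← Matrix.mul_assoc]
    exact opNorm_kron_le_of_le o (opNorm_sdiff_gradH_mul_calG_le n hn M a ha lam)
  have hE0 : ‖E‖ ≤ d * α := opNorm_defect_le (fine n M) ((n : ℕ) : ℂ) hα hR
  have h𝒢0 : ‖𝒢‖ ≤ Cst d a := opNorm_kron_le_of_le o (opNorm_calG_le n hn M a ha)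
  have hF0 : ‖Eᴴ * 𝒢‖ ≤ d * α * Cst d a :=
    (Matrix.l2_opNorm_mul _ _).trans (mul_le_mul (by rw [Matrix.l2_opNorm_conjTranspose]; exact hE0) h𝒢0 (norm_nonneg _) (by positivity))
  have hF1 : ∀ lam, ‖sdiff (fine n M) ((n : ℕ) : ℂ) lam ⊗ₖ (1 : Matrix o o ℂ) * (Eᴴ * 𝒢)‖ ≤ d * (α + β) * Cst d a := fun lam => by
    rw [← Matrix.mul_assoc]; exact opNorm_sdiff_defectH_mul_calG_le n hn M a ha hα hβ hR hLip lam
  -- the four terms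
  have ta : ‖G * (X - X₀) * Gᴴ * 𝒢‖ ≤ d * (ξ₀ * (d * Cst d a) + ρ₀ * (d * Cst d a)) := by
    rw [Matrix.mul_assoc]; exact opNorm_grad_mul_mul_le (fine n M) hY hB0 hB1
  have tb : ‖E * X * Gᴴ * 𝒢‖ ≤ d * α * ξ * (d * Cst d a) := by
    rw [Matrix.mul_assoc]
    exact (Matrix.l2_opNorm_mul _ _).trans (mul_le_mul ((Matrix.l2_opNorm_mul _ _).trans (mul_le_mul hE0 hX.norm_le (norm_nonneg _)
      (by positivity))) hB0 (norm_nonneg _) (by positivity))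
  have tc : ‖G * X * Eᴴ * 𝒢‖ ≤ d * (ξ * (d * (α + β) * Cst d a) + ρ * (d * α * Cst d a)) := by
    rw [Matrix.mul_assoc]; exact opNorm_grad_mul_mul_le (fine n M) hX hF0 hF1
  have td : ‖E * X * Eᴴ * 𝒢‖ ≤ d * α * ξ * (d * α * Cst d a) := by
    rw [Matrix.mul_assoc]
    exact (Matrix.l2_opNorm_mul _ _).trans (mul_le_mul ((Matrix.l2_opNorm_mul _ _).trans (mul_le_mul hE0 hX.norm_le (norm_nonneg _)
      (by positivity))) hF0 (norm_nonneg _) (by positivity))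
  rw [Matrix.add_mul, Matrix.add_mul, Matrix.add_mul]
  calc _ ≤ ‖G * (X - X₀) * Gᴴ * 𝒢‖ + ‖E * X * Gᴴ * 𝒢‖ + ‖G * X * Eᴴ * 𝒢‖ + ‖E * X * Eᴴ * 𝒢‖ :=
        (norm_add_le _ _).trans (add_le_add ((norm_add_le _ _).trans (add_le_add (norm_add_le _ _) le_rfl)) le_rfl)
    _ ≤ d * (ξ₀ * (d * Cst d a) + ρ₀ * (d * Cst d a)) + d * α * ξ * (d * Cst d a)
        + d * (ξ * (d * (α + β) * Cst d a) + ρ * (d * α * Cst d a)) + d * α * ξ * (d * α * Cst d a) :=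
        add_le_add (add_le_add (add_le_add ta tb) tc) td
    _ = kappaSand d a α β ξ ρ ξ₀ ρ₀ := by unfold kappaSand; ring

/-- **(H-bd) FOR THE GAUGE-TERM SANDWICH, LEFT**: `‖(𝒢 ⊗ 1)·(D_R X D_Rᴴ − D_1 X₀ D_1ᴴ)‖ ≤ κ_sand` under the same transporter
hypotheses and the gradient-commutator data of the ADJOINTS `Xᴴ`, `(X − X₀)ᴴ` (for Hermitian `X`, `X₀` — projections — the same data):
pass to the adjoint, `𝒢ᴴ = 𝒢`, `(D X Dᴴ)ᴴ = D Xᴴ Dᴴ`. [cite: Balaban1984PropagatorsI, Prop. 1.1 (1.89) p.33] [folklore] -/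
theorem opNorm_calG_mul_sandDiff_le {R : Fin d → (Tor (fine n M) → Matrix o o ℂ)} {X X₀ : Matrix (Tor (fine n M) × o) (Tor (fine n M) × o) ℂ}
    {α β ξ ρ ξ₀ ρ₀ : ℝ} (hα : 0 ≤ α) (hβ : 0 ≤ β) (hR : ∀ μ i, ‖connL (fine n M) ((n : ℕ) : ℂ) R μ i‖ ≤ α)
    (hLip : ∀ μ lam i, ‖connL (fine n M) ((n : ℕ) : ℂ) R μ (tau (fine n M) lam i) - connL (fine n M) ((n : ℕ) : ℂ) R μ i‖ ≤ β / n)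
    (hX : GradComm (fine n M) ((n : ℕ) : ℂ) Xᴴ ξ ρ) (hY : GradComm (fine n M) ((n : ℕ) : ℂ) (X - X₀)ᴴ ξ₀ ρ₀) :
    ‖calG n hn M a ha ⊗ₖ (1 : Matrix o o ℂ) * (sand (fine n M) ((n : ℕ) : ℂ) R X - sand (fine n M) ((n : ℕ) : ℂ) (fun _ _ => 1) X₀)‖
      ≤ kappaSand d a α β ξ ρ ξ₀ ρ₀ := by
  have hGH : (calG n hn M a ha ⊗ₖ (1 : Matrix o o ℂ))ᴴ = calG n hn M a ha ⊗ₖ (1 : Matrix o o ℂ) := by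
    rw [kron_conjTranspose, (calG_isHermitian n hn M a ha).eq]
  rw [← Matrix.l2_opNorm_conjTranspose, Matrix.conjTranspose_mul, hGH, Matrix.conjTranspose_sub, sand_conjTranspose, sand_conjTranspose]
  rw [Matrix.conjTranspose_sub] at hY
  exact opNorm_sandDiff_mul_calG_le n hn M a ha hα hβ hR hLip hX hY

end Level

/-! ## §3 The projection FACTORISED through an inner scalar resolvent ([Balaban1985BackgroundPropagators] (3.24)–(3.25) shapes):
`Δ′ = D_Rᴴ D_R + a′Q′ᴴQ′`, `Z = Q′G′D_Rᴴ`, `N = (Q′G′²Q′ᴴ)⁻¹`, `P = G′Q′ᴴNQ′G′` (`R(U) = 1 − P`), and the EXACT identity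
`D_R·P·D_Rᴴ = Zᴴ·N·Z` — the reading the B4.b law (`Support/GaugeTermSandwichLaw`, row B4.b) is built on: every factor bounded -/

section Factorised

variable (Nf : Fin d → ℕ) [hNf : ∀ μ, NeZero (Nf μ)] {o : Type*} [Fintype o] [DecidableEq o] {γ : Type*} [Fintype γ] [DecidableEq γ]

/-- the (3.24)-SHAPED inner scalar operator on colour 0-forms `Δ′ = D_Rᴴ·D_R + a′·Q′ᴴQ′` (transporters `R`, the scalar averaging `Q′`
to a coarse index type `γ`, and `a′` are DATA). [cite: Balaban1985BackgroundPropagators, (3.24) p.394 (shape)] [folklore] -/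
def scalOp (c : ℂ) (R : Fin d → (Tor Nf → Matrix o o ℂ)) (a' : ℝ) (Q' : Matrix γ (Tor Nf × o) ℂ) : Matrix (Tor Nf × o) (Tor Nf × o) ℂ :=
  (covGrad Nf c R)ᴴ * covGrad Nf c R + ((a' : ℝ) : ℂ) • (Q'ᴴ * Q')

omit [DecidableEq γ] in
/-- `Δ′` is Hermitian. [folklore] -/
theorem scalOp_isHermitian (c : ℂ) (R : Fin d → (Tor Nf → Matrix o o ℂ)) (a' : ℝ) (Q' : Matrix γ (Tor Nf × o) ℂ) :
    (scalOp Nf c R a' Q').IsHermitian := by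
  unfold scalOp Matrix.IsHermitian
  rw [Matrix.conjTranspose_add, Matrix.conjTranspose_smul, Matrix.conjTranspose_mul, Matrix.conjTranspose_mul,
    Matrix.conjTranspose_conjTranspose, Matrix.conjTranspose_conjTranspose, Complex.star_def, Complex.conj_ofReal]

/-- **`Z = Q′·G′·D_Rᴴ`**: fine colour 1-forms → coarse colour scalars (the right factor of the factorised gauge term). [folklore] -/
def Zop (c : ℂ) (R : Fin d → (Tor Nf → Matrix o o ℂ)) (G' : Matrix (Tor Nf × o) (Tor Nf × o) ℂ) (Q' : Matrix γ (Tor Nf × o) ℂ) :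
    Matrix γ ((Tor Nf × Fin d) × o) ℂ :=
  Q' * G' * (covGrad Nf c R)ᴴ

omit hNf in
/-- **`N = (Q′G′G′Q′ᴴ)⁻¹`** on the coarse layer (the middle factor; `Matrix.inv`, meaningful when `Q′G′²Q′ᴴ` is invertible). [folklore] -/
def Nop (G' : Matrix (Tor Nf × o) (Tor Nf × o) ℂ) (Q' : Matrix γ (Tor Nf × o) ℂ) : Matrix γ γ ℂ := (Q' * G' * G' * Q'ᴴ)⁻¹

/-- **`P = G′Q′ᴴ·N·Q′G′`** — the (3.25)-shaped operator whose complement `R = 1 − P` is Bałaban's projection, as a FUNCTION of the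
inner data `G′`, `Q′` (no claim that these are Bałaban's `G′(U)`, `Q′(U)`). [cite: Balaban1985BackgroundPropagators, (3.25) p.394
(shape); Balaban1984PropagatorsI, (1.70) p.30 (shape at `U = 1`)] [folklore] -/
def projP (G' : Matrix (Tor Nf × o) (Tor Nf × o) ℂ) (Q' : Matrix γ (Tor Nf × o) ℂ) : Matrix (Tor Nf × o) (Tor Nf × o) ℂ :=
  G' * Q'ᴴ * Nop Nf G' Q' * Q' * G'

omit [DecidableEq o] in
/-- `N` is Hermitian when `G′` is. [folklore] -/
theorem Nop_conjTranspose {G' : Matrix (Tor Nf × o) (Tor Nf × o) ℂ} (hG : G'.IsHermitian) (Q' : Matrix γ (Tor Nf × o) ℂ) :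
    (Nop Nf G' Q')ᴴ = Nop Nf G' Q' := by
  rw [Nop, Matrix.conjTranspose_nonsing_inv]
  congr 1
  rw [Matrix.conjTranspose_mul, Matrix.conjTranspose_mul, Matrix.conjTranspose_mul, Matrix.conjTranspose_conjTranspose, hG.eq]
  simp only [Matrix.mul_assoc]

omit [DecidableEq o] in
/-- `P` is Hermitian when `G′` is. [folklore] -/
theorem projP_conjTranspose {G' : Matrix (Tor Nf × o) (Tor Nf × o) ℂ} (hG : G'.IsHermitian) (Q' : Matrix γ (Tor Nf × o) ℂ) :
    (projP Nf G' Q')ᴴ = projP Nf G' Q' := by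
  rw [projP, Matrix.conjTranspose_mul, Matrix.conjTranspose_mul, Matrix.conjTranspose_mul, Matrix.conjTranspose_mul,
    Matrix.conjTranspose_conjTranspose, Nop_conjTranspose Nf hG, hG.eq]
  simp only [Matrix.mul_assoc]

omit [DecidableEq o] in
/-- `P² = P` when the middle matrix `Q′G′²Q′ᴴ` is invertible (so `P` and `1 − P` are projections). [folklore] -/
theorem projP_mul_projP {G' : Matrix (Tor Nf × o) (Tor Nf × o) ℂ} {Q' : Matrix γ (Tor Nf × o) ℂ}
    (hM : IsUnit (Q' * G' * G' * Q'ᴴ).det) : projP Nf G' Q' * projP Nf G' Q' = projP Nf G' Q' := by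
  have hN : Nop Nf G' Q' * (Q' * G' * G' * Q'ᴴ) = 1 := by rw [Nop]; exact Matrix.nonsing_inv_mul _ hM
  calc projP Nf G' Q' * projP Nf G' Q'
      = G' * Q'ᴴ * (Nop Nf G' Q' * (Q' * G' * G' * Q'ᴴ)) * Nop Nf G' Q' * Q' * G' := by
        simp only [projP, Matrix.mul_assoc]
    _ = projP Nf G' Q' := by rw [hN, Matrix.mul_one, projP]

/-- **THE EXACT FACTORISATION** `D_R·P·D_Rᴴ = Zᴴ·N·Z` for Hermitian `G′` — every factor a bounded operator once `‖G′D_Rᴴ‖` is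
(row B4.b: `‖D_RG′‖² ≤ ‖G′‖` by positivity for `G′ = Δ′⁻¹`). [folklore] -/
theorem sand_projP_eq (c : ℂ) (R : Fin d → (Tor Nf → Matrix o o ℂ)) {G' : Matrix (Tor Nf × o) (Tor Nf × o) ℂ} (hG : G'.IsHermitian)
    (Q' : Matrix γ (Tor Nf × o) ℂ) :
    sand Nf c R (projP Nf G' Q') = (Zop Nf c R G' Q')ᴴ * Nop Nf G' Q' * Zop Nf c R G' Q' := by
  rw [sand, projP, Zop, Matrix.conjTranspose_mul, Matrix.conjTranspose_mul, Matrix.conjTranspose_conjTranspose, hG.eq]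
  simp only [Matrix.mul_assoc]

omit hNf in
/-- the three-term split of a difference of factorised terms (instance shape of `GaugeTermSandwichLaw`'s splitting):
`Z₁ᴴN₁Z₁ − Z₀ᴴN₀Z₀ = (Z₁ − Z₀)ᴴN₁Z₁ + Z₀ᴴ(N₁ − N₀)Z₁ + Z₀ᴴN₀(Z₁ − Z₀)`. [folklore] -/
theorem factorised_sub {ι κ : Type*} [Fintype κ] (Z₁ Z₀ : Matrix κ ι ℂ) (N₁ N₀ : Matrix κ κ ℂ) :
    Z₁ᴴ * N₁ * Z₁ - Z₀ᴴ * N₀ * Z₀ = (Z₁ - Z₀)ᴴ * N₁ * Z₁ + Z₀ᴴ * (N₁ - N₀) * Z₁ + Z₀ᴴ * N₀ * (Z₁ - Z₀) := by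
  rw [Matrix.conjTranspose_sub]
  simp only [Matrix.sub_mul, Matrix.mul_sub]
  abel

/-- the gauge summand in factorised form: with `P_U = projP G′_U Q′_U`, `P_1 = projP G′_1 Q′_1` (Hermitian inner resolvents),
`D_R P_U D_Rᴴ − D_1 P_1 D_1ᴴ = (Z_U − Z_1)ᴴN_UZ_U + Z_1ᴴ(N_U − N_1)Z_U + Z_1ᴴN_1(Z_U − Z_1)` — all factors bounded; smallness from
`Z_U − Z_1`, `N_U − N_1` (row B4.b). [folklore] -/
theorem sand_projP_sub (c : ℂ) (R : Fin d → (Tor Nf → Matrix o o ℂ)) {G₁ G₀ : Matrix (Tor Nf × o) (Tor Nf × o) ℂ}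
    (h₁ : G₁.IsHermitian) (h₀ : G₀.IsHermitian) (Q₁ Q₀ : Matrix γ (Tor Nf × o) ℂ) :
    sand Nf c R (projP Nf G₁ Q₁) - sand Nf c (fun _ _ => 1) (projP Nf G₀ Q₀)
      = (Zop Nf c R G₁ Q₁ - Zop Nf c (fun _ _ => 1) G₀ Q₀)ᴴ * Nop Nf G₁ Q₁ * Zop Nf c R G₁ Q₁
        + (Zop Nf c (fun _ _ => 1) G₀ Q₀)ᴴ * (Nop Nf G₁ Q₁ - Nop Nf G₀ Q₀) * Zop Nf c R G₁ Q₁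
        + (Zop Nf c (fun _ _ => 1) G₀ Q₀)ᴴ * Nop Nf G₀ Q₀ * (Zop Nf c R G₁ Q₁ - Zop Nf c (fun _ _ => 1) G₀ Q₀) := by
  rw [sand_projP_eq Nf c R h₁, sand_projP_eq Nf c _ h₀, factorised_sub]

end Factorised

end Summit.QuantumFields.BalabanUV.T4Continuum.GaugeTermSandwichBound

end
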